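import Literature.NumberTheory.Rogawski1990.ArchUnitaryPlaneEigenframeCompact   -- ★ p847990: the `U(1,1)` engine `exists_isCompact_forall_isConj_of_mem_unitaryGroupOfForm_antidiag_two`
import Literature.NumberTheory.Rogawski1990.ArchimedeanTransfer                -- ★ `IsArchGRegular`, `IsArchStablyConjH`, `endoEmbArch`, `coe_endoEmbArch`
import Literature.NumberTheory.Automorphic.ArchStableConjugacyLocalGlobal       -- ★ `archPiEquivCM`, `isStablyConj_arch_iff_forall_place`, `coe_archPiEquivCM_apply`
import Literature.LinearAlgebra.Matrix.RegularSemisimpleConjClassClosed         -- ★ `continuous_charpoly_coeff`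
import Mathlib.Analysis.Polynomial.CauchyBound
import HarnessLib

/-!
# A `G`-regular `γ_H ∈ H_∞` whose image `ι_∞(γ_H)` is conjugate into a compact subset of `GL₃(L ⊗ ℝ)` is stably conjugate into ONE compact subset of `H_∞`
(the «bounded modulo `Z₁(ℝ)`» clause in the proof of Shelstad 2012, Cor. 2.2; Rogawski 1990 §3.1, §3.6, §4.3, §14.3)

Topic `NumberTheory/Rogawski1990`; namespace `Literature.NumberTheory.Rogawski1990`.  THEOREMS ONLY (no definition, no instance, no notation, no axiom, no named
fact, no `sorry`).  Cell `pub/hodgecm-mathlib`, F0∕P3c line LH3 (crux H413 = `stmt-HodgeConjecture-24833`, closer stub `stub_N9` = the archimedean endoscopic transfer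
★ `ArchEndoscopicTransferCompatible` at print's `Δ″_∞`): the sub-lemma **(EIG→CPT)** of organ O2 `stub_N9transferSideBounded` of the pay-down skeleton
`StubN9.paydown.skeleton.v1` (LH3-plan (g0)), in the interface fixed by the O2 owner LH3-p02 (g0) (bus `F0/P3c/LH3/STATUS.md`, 2026-09-02T02:22:04Z).

THE STATEMENT (`H_∞ = U(Φ₂)(L⁺ ⊗ ℝ) × U(Φ₁)(L⁺ ⊗ ℝ)`, `ι_∞ = ★ endoEmbArch`).  For every compact `K ⊆ GL₃(L ⊗ ℝ)` there is a compact `C ⊆ H_∞` such that every `G`-regular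
`γ_H ∈ H_∞` (★ `IsArchGRegular`) with `ι_∞(γ_H)` conjugate IN `GL₃(L ⊗ ℝ)` to an element of `K` is stably conjugate (★ `IsArchStablyConjH`: componentwise `GL`-conjugacy) to an
element of `C`.  In O2 one takes `K = tsupport a′` for `a′ ∈ C_c^∞(G′_∞)`: a non-zero term `Δ″_∞(γ_H, γ′) Φ([γ′], a′)` forces `ι_∞(γ_H) ↔ γ′` (a norm pair = `GL₃(L ⊗ ℝ)`-conjugacy)
with `[γ′]` meeting `tsupport a′`; so the `Δ″`-side of the transfer identity vanishes at the `G`-regular `γ_H` off the stable classes meeting `C` — Shelstad's «the stable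
orbital integrals … vanish off the conjugacy classes meeting a set bounded modulo `Z₁(ℝ)`» (here `Z(H_∞)` is compact).

THE PROOF.  Place by place (★ `archPiEquivCM : U(Φ₂)(L⁺ ⊗ ℝ) ≃ₜ* Π_w U(Φ₂)_w`, ★ `isStablyConj_arch_iff_forall_place`): at a complex place `w`, `ι_∞(γ_H)_w = ι(γ_{2,w}, γ_{1,w})`
(★ `map_endoGL`) is `GL₃(ℂ)`-conjugate to `k_w`, so `charpoly γ_{2,w} · charpoly γ_{1,w} = charpoly k_w` (★ `charpoly_endoGL`, `Matrix.charpoly_units_conj`) and every eigenvalue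
`z` of `γ_{2,w}` is a root of `charpoly k_w`, whence `|z| < cauchyBound (charpoly k_w) ≤ R_w(K)` (Mathlib `Polynomial.IsRoot.norm_lt_cauchyBound`; the coefficients of the
characteristic polynomial are continuous, ★ `continuous_charpoly_coeff`, and `K` is compact).  `γ_{2,w} ∈ U(Φ₂)_w ≅ U(1,1)` is regular semisimple (`G`-regularity, ★
`charpoly_endoGL`, separability is preserved by the place map), so the engine ★ `exists_isCompact_forall_isConj_of_mem_unitaryGroupOfForm_antidiag_two` conjugates it in
`GL₂(ℂ)` into a compact `C_w ⊆ U(Φ₂)_w` depending only on `R_w`.  Glue: `C = archPiEquivCM⁻¹(Π_w C_w) ×ˢ U(Φ₁)_∞`, the second factor being compact (★ `isCompact_arch_cm`,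
`Φ₁ = (1)` is definite).

* §1 `exists_forall_isRoot_charpoly_norm_le_of_isCompact` — a uniform bound for the roots of the characteristic polynomials of a compact family of matrices;
* §2 `charpoly_map_evalC_mul_eq_of_isConj_endoEmbArch` — the place-`w` characteristic-polynomial identity of a conjugate pair `ι_∞(γ_H) ∼ k`;
* §3 **`exists_isCompact_isArchStablyConjH_of_isConj_endoEmbArch`** — the head, LH3-p02's interface VERBATIM.
HONEST LABEL: HC_CM is proved only modulo the 7 printed citations (2 remaining: hLiu418 = `stmt-HodgeConjecture-24832`, h413 = `stmt-HodgeConjecture-24833`) until rung 0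
closes; this file is Lie-group bookkeeping for O2 and pays nothing by itself.

## References
* [Shelstad2012] D. Shelstad, *On geometric transfer in real twisted endoscopy*, Ann. of Math. 176 (2012), Cor. 2.2 p. 1926 (proof: «… vanish off the conjugacy classes meeting
  a set … bounded modulo `Z₁(ℝ)`»).
* [Rogawski1990] J. D. Rogawski, *Automorphic Representations of Unitary Groups in Three Variables*, Ann. of Math. Stud. 123 (1990), §3.1 p. 19 (stable conjugacy), §3.6 p. 31
  (Cartan subgroups), §4.3 p. 42 (`G`-regular elements of `H`), §14.3 p. 234 (the archimedean transfer `f′_∞ → f′^H_∞`).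
* [BorelJacquet1979] A. Borel, H. Jacquet, *Automorphic forms and automorphic representations*, PSPM 33.1 (1979), §4.1 (`G_∞ = Π_{v∣∞} G(F_v)`).
-/

set_option autoImplicit false

noncomputable section

open Matrix Topology Polynomial NumberField NumberField.InfinitePlace NumberField.mixedEmbedding
open Literature.NumberTheory.Automorphic Literature.NumberTheory.Automorphic.UnitaryGroup
open scoped MatrixGroups ComplexConjugate NNReal ComplexOrder

namespace Literature.NumberTheory.Rogawski1990

/-! ## §1 Roots of the characteristic polynomials of a compact family of complex matrices are uniformly bounded -/

section RootBound

variable {X : Type*} [TopologicalSpace X] {N : ℕ}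

/-- **Uniform root bound on a compact family.**  If `f : X → M_N(ℂ)` is continuous on a compact `K`, there is `R` with `|z| ≤ R` for every root `z` of the characteristic
polynomial of every `f x`, `x ∈ K` (Cauchy's bound `1 + max_i |a_i|` on the roots of a monic polynomial, Mathlib `Polynomial.IsRoot.norm_lt_cauchyBound`; the coefficients
`x ↦ a_i(x)` are continuous, ★ `Literature.LinearAlgebra.Matrix.continuous_charpoly_coeff`, hence bounded on `K`). [folklore] [cite: HornJohnson2013, Thm 1.2.16] -/
theorem exists_forall_isRoot_charpoly_norm_le_of_isCompact {K : Set X} (hK : IsCompact K) {f : X → Matrix (Fin N) (Fin N) ℂ} (hf : Continuous f) :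
    ∃ R : ℝ, ∀ x ∈ K, ∀ z : ℂ, (f x).charpoly.IsRoot z → ‖z‖ ≤ R := by
  classical
  have hb : ∀ i : ℕ, ∃ C : ℝ, ∀ x ∈ K, ‖(f x).charpoly.coeff i‖ ≤ C := fun i =>
    hK.exists_bound_of_continuousOn (((Literature.LinearAlgebra.Matrix.continuous_charpoly_coeff i).comp hf).continuousOn)
  choose C hC using hb
  set M : ℝ≥0 := (Finset.range N).sup fun i => Real.toNNReal (C i) with hM
  refine ⟨(M : ℝ) + 1, fun x hx z hz => ?_⟩
  have hp0 : (f x).charpoly ≠ 0 := (Matrix.charpoly_monic _).ne_zero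
  have hlt := Polynomial.IsRoot.norm_lt_cauchyBound hp0 hz
  have hcb : Polynomial.cauchyBound (f x).charpoly ≤ M + 1 := by
    unfold Polynomial.cauchyBound
    rw [(Matrix.charpoly_monic (f x)).leadingCoeff, nnnorm_one, div_one, Matrix.charpoly_natDegree_eq_dim, Fintype.card_fin]
    refine add_le_add (Finset.sup_le fun i hi => ?_) le_rfl
    calc ‖(f x).charpoly.coeff i‖₊ ≤ Real.toNNReal (C i) := by
          rw [← NNReal.coe_le_coe, coe_nnnorm]
          exact (hC i x hx).trans (Real.le_coe_toNNReal (C i))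
      _ ≤ M := Finset.le_sup (f := fun i => Real.toNNReal (C i)) hi
  have h : (‖z‖₊ : ℝ) ≤ (M : ℝ) + 1 := by exact_mod_cast (hlt.trans_le hcb).le
  simpa only [coe_nnnorm] using h

end RootBound

/-! ## §2 The place-`w` characteristic polynomials of a conjugate pair `ι_∞(γ_H) ∼ k` -/

section Place

variable (L : Type) [Field L] [NumberField L] [IsCMField L]

/-- **At a complex place `w`: `charpoly γ_{2,w} · charpoly γ_{1,w} = charpoly k_w`** whenever `ι_∞(γ_H)` (★ `endoEmbArch`, matrix `(a 0 b; 0 u 0; c 0 d)`) is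
`GL₃(L ⊗ ℝ)`-conjugate to `k` (the place map `GL₃(evalC w)` is a group homomorphism commuting with `ι`, ★ `map_endoGL`; ★ `charpoly_endoGL`; conjugate matrices have the
same characteristic polynomial). [cite: Rogawski1990, §4.3 p. 42; §14.3 p. 234] [cite: BorelJacquet1979, §4.1] -/
theorem charpoly_map_evalC_mul_eq_of_isConj_endoEmbArch
    (γH : ↥(UnitaryGroup.arch (↥(maximalRealSubfield L)) L (IsCMField.complexConj L) 2 (Matrix.of fun i j : Fin 2 => if i.val + j.val + 1 = 2 then (1 : L) else 0)) ×
      ↥(UnitaryGroup.arch (↥(maximalRealSubfield L)) L (IsCMField.complexConj L) 1 (Matrix.of fun i j : Fin 1 => if i.val + j.val + 1 = 1 then (1 : L) else 0)))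
    {k : GL (Fin 3) (mixedSpace L)} (hk : IsConj ((endoEmbArch L γH).val : GL (Fin 3) (mixedSpace L)) k)
    (w : {w : InfinitePlace L // IsComplex w}) :
    ((Matrix.GeneralLinearGroup.map (evalC L w) (γH.1.val : GL (Fin 2) (mixedSpace L)) : GL (Fin 2) ℂ) : Matrix (Fin 2) (Fin 2) ℂ).charpoly *
        ((Matrix.GeneralLinearGroup.map (evalC L w) (γH.2.val : GL (Fin 1) (mixedSpace L)) : GL (Fin 1) ℂ) : Matrix (Fin 1) (Fin 1) ℂ).charpoly =
      ((Matrix.GeneralLinearGroup.map (evalC L w) k : GL (Fin 3) ℂ) : Matrix (Fin 3) (Fin 3) ℂ).charpoly := by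
  have hw := (Matrix.GeneralLinearGroup.map (n := Fin 3) (evalC L w)).map_isConj hk
  rw [coe_endoEmbArch, map_endoGL] at hw
  obtain ⟨c, hc⟩ := isConj_iff.1 hw
  have h := congrArg (fun g : GL (Fin 3) ℂ => (g : Matrix (Fin 3) (Fin 3) ℂ).charpoly) hc
  simp only [Units.val_mul, Matrix.coe_units_inv, Matrix.charpoly_units_conj, charpoly_endoGL] at h
  exact h

end Place

/-! ## §3 The head (EIG→CPT): stable conjugation into ONE compact subset of `H_∞` -/

section Head

/-- **(EIG→CPT) — LH3-p02's interface verbatim.**  For every compact `K ⊆ GL₃(L ⊗ ℝ)` there is a compact `C ⊆ H_∞ = U(Φ₂)(L⁺ ⊗ ℝ) × U(Φ₁)(L⁺ ⊗ ℝ)` such that every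
`G`-regular `γ_H ∈ H_∞` whose image `ι_∞(γ_H)` is `GL₃(L ⊗ ℝ)`-conjugate to an element of `K` is stably conjugate (★ `IsArchStablyConjH`) to an element of `C` — the
«bounded modulo `Z₁(ℝ)`» clause of the proof of [Shelstad2012, Cor. 2.2] for `(G′_∞, H_∞)`: per complex place the eigenvalues of `γ_{2,w}` are roots of `charpoly k_w`
(§2), uniformly bounded on `K` (§1), and a regular semisimple element of `U(Φ₂)_w ≅ U(1,1)` with bounded eigenvalues is `GL₂(ℂ)`-conjugate into a fixed compact
(★ `exists_isCompact_forall_isConj_of_mem_unitaryGroupOfForm_antidiag_two`); `U(Φ₁)_∞` is compact; glue place by place (★ `isStablyConj_arch_iff_forall_place`).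
[cite: Shelstad2012, Cor. 2.2 p. 1926] [cite: Rogawski1990, §3.1 p. 19; §3.6 p. 31; §4.3 p. 42; §14.3 p. 234] -/
theorem exists_isCompact_isArchStablyConjH_of_isConj_endoEmbArch
    (L : Type) [Field L] [NumberField L] [IsCMField L]
    (K : Set (GL (Fin 3) (NumberField.mixedEmbedding.mixedSpace L))) (hK : IsCompact K) :
    ∃ C : Set (↥(UnitaryGroup.arch (↥(NumberField.maximalRealSubfield L)) L (IsCMField.complexConj L) 2
              (Matrix.of fun i j : Fin 2 => if i.val + j.val + 1 = 2 then (1 : L) else 0)) ×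
            ↥(UnitaryGroup.arch (↥(NumberField.maximalRealSubfield L)) L (IsCMField.complexConj L) 1
              (Matrix.of fun i j : Fin 1 => if i.val + j.val + 1 = 1 then (1 : L) else 0))),
      IsCompact C ∧
        ∀ γH, Literature.NumberTheory.Rogawski1990.IsArchGRegular L γH →
          (∃ k ∈ K, IsConj ((Literature.NumberTheory.Rogawski1990.endoEmbArch L γH).val
                              : GL (Fin 3) (NumberField.mixedEmbedding.mixedSpace L)) k) →
            ∃ δ ∈ C, Literature.NumberTheory.Rogawski1990.IsArchStablyConjH L γH δ := by
  classical
  -- §1 per place: a root bound `R w` on `K`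
  have hR : ∀ w : {w : InfinitePlace L // IsComplex w}, ∃ R : ℝ, ∀ k ∈ K, ∀ z : ℂ,
      (((Matrix.GeneralLinearGroup.map (evalC L w) k : GL (Fin 3) ℂ)) : Matrix (Fin 3) (Fin 3) ℂ).charpoly.IsRoot z → ‖z‖ ≤ R := fun w =>
    exists_forall_isRoot_charpoly_norm_le_of_isCompact hK
      (f := fun k : GL (Fin 3) (mixedSpace L) => (((Matrix.GeneralLinearGroup.map (evalC L w) k : GL (Fin 3) ℂ)) : Matrix (Fin 3) (Fin 3) ℂ))
      (Units.continuous_val.comp (continuous_evalC L w).generalLinearGroup_map)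
  choose R hR using hR
  -- the engine's compact sets `Cw w ⊆ U(Φ₂)_w`
  have hE := fun w : {w : InfinitePlace L // IsComplex w} => exists_isCompact_forall_isConj_of_mem_unitaryGroupOfForm_antidiag_two (R w)
  choose Cw hCwc hCwU hCw using hE
  -- `U(Φ₂)_w` is the engine's `U(Φ₂)(ℂ)`
  have hloc_eq : ∀ w : {w : InfinitePlace L // IsComplex w},
      archLocal L 2 (Matrix.of fun i j : Fin 2 => if i.val + j.val + 1 = 2 then (1 : L) else 0) w =
        unitaryGroupOfForm (starRingEnd ℂ) (Matrix.of fun i j : Fin 2 => if i.val + j.val + 1 = 2 then (1 : ℂ) else 0) := fun w => by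
    unfold archLocal
    rw [antidiagOne_map]
  -- the compact set `C₂ = archPiEquivCM⁻¹ (Π_w Cw w)`
  set e := archPiEquivCM 2 L (Matrix.of fun i j : Fin 2 => if i.val + j.val + 1 = 2 then (1 : L) else 0) with he
  set C₂ : Set ↥(UnitaryGroup.arch (↥(maximalRealSubfield L)) L (IsCMField.complexConj L) 2 (Matrix.of fun i j : Fin 2 => if i.val + j.val + 1 = 2 then (1 : L) else 0)) :=
    e ⁻¹' (Set.univ.pi fun w => Subtype.val ⁻¹' Cw w) with hC₂
  have hC₂c : IsCompact C₂ :=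
    (e.toHomeomorph.isCompact_preimage).2
      (isCompact_univ_pi fun w => (isClosed_archLocal L 2 _ w).isClosedEmbedding_subtypeVal.isCompact_preimage (hCwc w))
  -- `U(Φ₁)_∞` is compact
  haveI : CompactSpace ↥(UnitaryGroup.arch (↥(maximalRealSubfield L)) L (IsCMField.complexConj L) 1 (Matrix.of fun i j : Fin 1 => if i.val + j.val + 1 = 1 then (1 : L) else 0)) := by
    refine isCompact_iff_compactSpace.1 (isCompact_arch_cm (N := 1) (L := L) (H := _) fun w => Or.inl ?_)
    have h1 : (Matrix.of fun i j : Fin 1 => if i.val + j.val + 1 = 1 then (1 : L) else 0).map w.1.embedding = 1 := by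
      ext i j; fin_cases i; fin_cases j
      simp [Matrix.map_apply]
    rw [h1]
    exact Matrix.PosDef.one
  refine ⟨C₂ ×ˢ Set.univ, hC₂c.prod isCompact_univ, ?_⟩
  rintro γH hreg ⟨k, hkK, hconj⟩
  -- the 2-block is regular semisimple
  have hreg2 : (((γH.1.val : GL (Fin 2) (mixedSpace L))) : Matrix (Fin 2) (Fin 2) (mixedSpace L)).charpoly.Separable := by
    have h : IsRegularElt ((endoEmbArch L γH).val : GL (Fin 3) (mixedSpace L)) := hreg
    rw [isRegularElt_iff, coe_endoEmbArch, charpoly_endoGL] at h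
    exact h.of_mul_left
  -- per place: a representative in `Cw w`
  have hloc : ∀ w : {w : InfinitePlace L // IsComplex w}, ∃ δw : GL (Fin 2) ℂ, δw ∈ Cw w ∧
      IsConj (Matrix.GeneralLinearGroup.map (evalC L w) (γH.1.val : GL (Fin 2) (mixedSpace L))) δw := fun w => by
    refine hCw w _ ?_ ?_ ?_
    · rw [← hloc_eq w]
      exact (e γH.1 w).2
    · have hval : ((Matrix.GeneralLinearGroup.map (evalC L w) (γH.1.val : GL (Fin 2) (mixedSpace L)) : GL (Fin 2) ℂ) : Matrix (Fin 2) (Fin 2) ℂ) =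
          (((γH.1.val : GL (Fin 2) (mixedSpace L))) : Matrix (Fin 2) (Fin 2) (mixedSpace L)).map (evalC L w) := rfl
      rw [hval, Matrix.charpoly_map]
      exact hreg2.map
    · intro z hz
      refine hR w k hkK z ?_
      rw [← charpoly_map_evalC_mul_eq_of_isConj_endoEmbArch L γH hconj w]
      exact Polynomial.root_mul.2 (Or.inl hz)
  choose δw hδwC hδw using hloc
  have hmem : ∀ w : {w : InfinitePlace L // IsComplex w},
      δw w ∈ archLocal L 2 (Matrix.of fun i j : Fin 2 => if i.val + j.val + 1 = 2 then (1 : L) else 0) w := fun w => by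
    rw [hloc_eq w]
    exact hCwU w (hδwC w)
  -- glue
  set δ₂ : ↥(UnitaryGroup.arch (↥(maximalRealSubfield L)) L (IsCMField.complexConj L) 2 (Matrix.of fun i j : Fin 2 => if i.val + j.val + 1 = 2 then (1 : L) else 0)) :=
    e.symm fun w => ⟨δw w, hmem w⟩ with hδ₂
  have heδ : e δ₂ = fun w => ⟨δw w, hmem w⟩ := by rw [hδ₂, ContinuousMulEquiv.apply_symm_apply]
  refine ⟨(δ₂, γH.2), ⟨?_, Set.mem_univ _⟩, ?_⟩
  · show e δ₂ ∈ Set.univ.pi fun w => Subtype.val ⁻¹' Cw w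
    rw [heδ]
    exact fun w _ => hδwC w
  · unfold IsArchStablyConjH IsStablyConjH
    refine ⟨?_, IsStablyConj.refl _⟩
    rw [isStablyConj_arch_iff_forall_place]
    intro w
    obtain ⟨c, hc⟩ := isConj_iff.1 (hδw w)
    refine isStablyConj_iff.2 ⟨c, ?_⟩
    have h2 : ((archPiEquivCM 2 L _ δ₂ w : ↥(archLocal L 2 _ w)) : GL (Fin 2) ℂ) = δw w := by
      rw [← he, heδ]
    rw [coe_archPiEquivCM_apply, h2]
    exact hc

end Head

end Literature.NumberTheory.Rogawski1990

end
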